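import Mathlib
import HarnessLib
import Summits.Ventures.LatticeQCDFlow.Exactness.NCMCGeneralSpaceOccupancyChainCLT
import Summits.Ventures.LatticeQCDFlow.Exactness.NCMCGeneralSpaceOccupancyChainDoeblinSweeps

/-!
# END TO END for the `composite_sweep` instance (heat-bath link sweep then any exact update, e.g. `1HB + n_or` over-relaxation): Gaussian `√n`-fluctuations of the occupancy and of `dF_occ` from EVERY initial gauge field, for every `c ≠ ΔF`

HONEST FRAMING: exact (Metropolis-corrected) sampling algorithms for lattice gauge theory;
figures of merit are autocorrelation/cost numbers at stated couplings and volumes; no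
continuum-physics claim.

Venture `LatticeQCDFlow` (cell pub-lqcd), topic `Exactness`; FANOUT row 13 (`eng-snf`, GEN-19).
NEW WORK of the cell, not a published result; no definition is introduced; nothing is cited as a
fact.  ASSEMBLY of GEN-19's NCMC central limit theorems (`NCMCGeneralSpaceOccupancyChainCLT`:
`CrooksPair.ncmc_occupancy_clt_of_exists_sq`, `CrooksPair.ncmc_dFocc_clt_of_exists_sq`) with GEN-18's
two-step certificate for COMPOSITE level samplers `η ∘ₖ K` (`NCMCGeneralSpaceOccupancyChainDoeblinSweeps`:
`CrooksPair.ncmc_comp_exists_sq_doeblin` — a minorised heat-bath sweep `K` followed by any exact move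
`η` keeps the Doeblin square; `wilson_heatBath_minorising`, `wilson_heatBathSweep_package`; the
Jarzynski sign `CrooksPair.bind_work_ne_ne_zero_of_ne`).  Engine: `latflow-snf`,
`correction = ncmc-metropolis`, between two Wilson couplings on the periodic lattice with compact
structure group, level samplers `composite_sweep` = one heat-bath link sweep then `n_or` over-relaxation
(or any other exact) sweeps, ANY Crooks pair, ANY `c ≠ ΔF`.

## Content

* **`CrooksPair.ncmc_wilsonHeatBathComp_occupancy_clt_of_ne`** — for every initial state `z` and
  every `Y ~ N(0, 2 τ_int(ρ_occ) σ(1 − σ))`: `√n (p̂_n − σ(c − ΔF)) ⇒ Y` under `P_{δ_z}`.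
* **`CrooksPair.ncmc_wilsonHeatBathComp_dFocc_clt_of_ne`** — for every
  `Y ~ N(0, 2 τ_int(ρ_occ)/(σ(1 − σ)))`: `√n (dF_occ,n − ΔF) ⇒ Y` under `P_{δ_z}`.

NOT CLAIMED: the value of `τ_int(ρ_occ)` or of the Doeblin constant (measured figures of merit); a
typed consistent estimator of `τ_int`; rates; `c = ΔF` with `W ≡ ΔF`; over-relaxation-only samplers.
-/

namespace Summit.Ventures.LatticeQCDFlow.Exactness.GeneralNCMC

open MeasureTheory ProbabilityTheory Set Filter Finset
open scoped ENNReal Topology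

section WilsonComp

open Literature.MathematicalPhysics.QuantumFieldTheory

variable {d L N : ℕ} {G : Type*} [Group G] [TopologicalSpace G] [IsTopologicalGroup G]
  (ρ : G →* Matrix (Fin N) (Fin N) ℂ) [CompactSpace G] [MeasurableSpace G] [BorelSpace G]
  [SecondCountableTopology G]

/-- **THE OCCUPANCY CLT FOR THE `composite_sweep` INSTANCE, FROM EVERY INITIAL STATE, EVERY `c ≠ ΔF`.**
Torus Wilson theory; level samplers = heat-bath link sweep at `β_k` (edge list visiting every edge)
followed by ANY Markov kernel `η_k` leaving `wilsonWeight ρ β_k` invariant (the engine's `n_or`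
over-relaxation sweeps); ANY Crooks pair; `c ≠ ΔF`: for every initial state `z` and every
`Y ~ N(0, 2 τ_int(ρ_occ) σ(1 − σ))`, `√n (p̂_n − σ(c − ΔF)) ⇒ Y` under `P_{δ_z}`. -/
theorem CrooksPair.ncmc_wilsonHeatBathComp_occupancy_clt_of_ne [NeZero L] (hρ : Continuous ρ) (β₀ β₁ : ℝ)
    {l₀ l₁ : List (Edge d L)} (hl₀ : ∀ ed, ed ∈ l₀) (hl₁ : ∀ ed, ed ∈ l₁)
    (η₀ η₁ : Kernel (GaugeConfig d L G) (GaugeConfig d L G)) [IsMarkovKernel η₀] [IsMarkovKernel η₁]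
    (hη₀ : Kernel.Invariant η₀ (wilsonWeight (d := d) (L := L) ρ β₀))
    (hη₁ : Kernel.Invariant η₁ (wilsonWeight (d := d) (L := L) ρ β₁))
    {E : Type*} [MeasurableSpace E] {κF κR : Kernel (GaugeConfig d L G) E} [IsMarkovKernel κF]
    [IsMarkovKernel κR] {s e : E → GaugeConfig d L G} {W : E → ℝ}
    (h : CrooksPair (wilsonWeight (d := d) (L := L) ρ β₀) (wilsonWeight (d := d) (L := L) ρ β₁)
      κF κR s e W) {c ΔF : ℝ}
    (hΔF : Real.exp (-ΔF) = (((wilsonWeight (d := d) (L := L) ρ β₀) univ)⁻¹ *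
      (wilsonWeight (d := d) (L := L) ρ β₁) univ).toReal) (hc : c ≠ ΔF) :
    ∃ (_ : IsMarkovKernel (switchKernel κF κR c W s e))
      (_ : IsMarkovKernel (levelKernel
        (η₀ ∘ₖ cycle (l₀.map (siteHeatBath (fun _ : Edge d L => haarProbability G)
              (gibbsDensity fun U : GaugeConfig d L G => β₀ * wilsonAction ρ U))))
        (η₁ ∘ₖ cycle (l₁.map (siteHeatBath (fun _ : Edge d L => haarProbability G)
              (gibbsDensity fun U : GaugeConfig d L G => β₁ * wilsonAction ρ U)))))),
      ∀ (z : Bool × GaugeConfig d L G)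
        [IsProbabilityMeasure (Kernel.trajMeasure (X := fun _ : ℕ => Bool × GaugeConfig d L G)
            (Measure.dirac z)
            (fun n : ℕ => (switchKernel κF κR c W s e ∘ₖ levelKernel
              (η₀ ∘ₖ cycle (l₀.map (siteHeatBath (fun _ : Edge d L => haarProbability G)
              (gibbsDensity fun U : GaugeConfig d L G => β₀ * wilsonAction ρ U))))
              (η₁ ∘ₖ cycle (l₁.map (siteHeatBath (fun _ : Edge d L => haarProbability G)
              (gibbsDensity fun U : GaugeConfig d L G => β₁ * wilsonAction ρ U))))).comap
              (fun hh : (j : ↥(Finset.Iic n)) → Bool × GaugeConfig d L G =>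
                hh ⟨n, Finset.mem_Iic.2 le_rfl⟩) (measurable_pi_apply _)))]
        {Ω' : Type*} [MeasurableSpace Ω'] {P' : Measure Ω'} [IsProbabilityMeasure P'] {Y : Ω' → ℝ},
        HasLaw Y (gaussianReal 0 (Real.toNNReal
          (2 * Scoring.tauInt (setACF (switchKernel κF κR c W s e ∘ₖ levelKernel
              (η₀ ∘ₖ cycle (l₀.map (siteHeatBath (fun _ : Edge d L => haarProbability G)
              (gibbsDensity fun U : GaugeConfig d L G => β₀ * wilsonAction ρ U))))
              (η₁ ∘ₖ cycle (l₁.map (siteHeatBath (fun _ : Edge d L => haarProbability G)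
              (gibbsDensity fun U : GaugeConfig d L G => β₁ * wilsonAction ρ U)))))
            ((jointWeight c (wilsonWeight (d := d) (L := L) ρ β₀)
                (wilsonWeight (d := d) (L := L) ρ β₁) univ)⁻¹ •
              jointWeight c (wilsonWeight (d := d) (L := L) ρ β₀) (wilsonWeight (d := d) (L := L) ρ β₁))
            (targetLevel (GaugeConfig d L G)))
            * (Real.sigmoid (c - ΔF) * (1 - Real.sigmoid (c - ΔF)))))) P' →
        TendstoInDistribution (fun (n : ℕ) (x : ℕ → Bool × GaugeConfig d L G) =>
            Real.sqrt n * ((∑ i ∈ range n, (targetLevel (GaugeConfig d L G)).indicator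
              (1 : Bool × GaugeConfig d L G → ℝ) (x i)) / n - Real.sigmoid (c - ΔF)))
          atTop Y (fun _ => Kernel.trajMeasure (X := fun _ : ℕ => Bool × GaugeConfig d L G)
            (Measure.dirac z)
            (fun n : ℕ => (switchKernel κF κR c W s e ∘ₖ levelKernel
              (η₀ ∘ₖ cycle (l₀.map (siteHeatBath (fun _ : Edge d L => haarProbability G)
              (gibbsDensity fun U : GaugeConfig d L G => β₀ * wilsonAction ρ U))))
              (η₁ ∘ₖ cycle (l₁.map (siteHeatBath (fun _ : Edge d L => haarProbability G)
              (gibbsDensity fun U : GaugeConfig d L G => β₁ * wilsonAction ρ U))))).comap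
              (fun hh : (j : ↥(Finset.Iic n)) → Bool × GaugeConfig d L G =>
                hh ⟨n, Finset.mem_Iic.2 le_rfl⟩) (measurable_pi_apply _))) P' := by
  obtain ⟨hMk₀, hfin₀, -, -, h0, -, hK₀, -⟩ := wilson_heatBathSweep_package ρ hρ β₀ hl₀
  obtain ⟨hMk₁, hfin₁, -, -, h1, -, hK₁, -⟩ := wilson_heatBathSweep_package ρ hρ β₁ hl₁
  obtain ⟨m₀, hmfin₀, hm₀, hmin₀, hac₀⟩ := wilson_heatBath_minorising ρ hρ β₀ hl₀
  obtain ⟨m₁, hmfin₁, hm₁, hmin₁, hac₁⟩ := wilson_heatBath_minorising ρ hρ β₁ hl₁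
  haveI := hMk₀
  haveI := hMk₁
  haveI := hfin₀
  haveI := hfin₁
  haveI := hmfin₀
  haveI := hmfin₁
  refine ⟨isMarkovKernel_switchKernel (κF := κF) (κR := κR) (c := c)
      h.measurable_W h.measurable_s h.measurable_e, isMarkovKernel_levelKernel _ _,
    fun z _ Ω' _ P' _ Y hY => ?_⟩
  exact h.ncmc_occupancy_clt_of_exists_sq h0 h1 (hη₀.comp hK₀) (hη₁.comp hK₁)
    (h.ncmc_comp_exists_sq_doeblin _ η₀ _ η₁ hη₀ hη₁ hm₀ hm₁ hmin₀ hmin₁ hac₀ hac₁ c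
      (h.bind_work_ne_ne_zero_of_ne h0 hΔF hc)) hΔF z hY

/-- **THE `dF_occ` CLT FOR THE `composite_sweep` INSTANCE, FROM EVERY INITIAL STATE, EVERY `c ≠ ΔF`**:
for every initial state `z` and every `Y ~ N(0, 2 τ_int(ρ_occ)/(σ(1 − σ)))`,
`√n (dF_occ,n − ΔF) ⇒ Y` under `P_{δ_z}`. -/
theorem CrooksPair.ncmc_wilsonHeatBathComp_dFocc_clt_of_ne [NeZero L] (hρ : Continuous ρ) (β₀ β₁ : ℝ)
    {l₀ l₁ : List (Edge d L)} (hl₀ : ∀ ed, ed ∈ l₀) (hl₁ : ∀ ed, ed ∈ l₁)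
    (η₀ η₁ : Kernel (GaugeConfig d L G) (GaugeConfig d L G)) [IsMarkovKernel η₀] [IsMarkovKernel η₁]
    (hη₀ : Kernel.Invariant η₀ (wilsonWeight (d := d) (L := L) ρ β₀))
    (hη₁ : Kernel.Invariant η₁ (wilsonWeight (d := d) (L := L) ρ β₁))
    {E : Type*} [MeasurableSpace E] {κF κR : Kernel (GaugeConfig d L G) E} [IsMarkovKernel κF]
    [IsMarkovKernel κR] {s e : E → GaugeConfig d L G} {W : E → ℝ}
    (h : CrooksPair (wilsonWeight (d := d) (L := L) ρ β₀) (wilsonWeight (d := d) (L := L) ρ β₁)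
      κF κR s e W) {c ΔF : ℝ}
    (hΔF : Real.exp (-ΔF) = (((wilsonWeight (d := d) (L := L) ρ β₀) univ)⁻¹ *
      (wilsonWeight (d := d) (L := L) ρ β₁) univ).toReal) (hc : c ≠ ΔF) :
    ∃ (_ : IsMarkovKernel (switchKernel κF κR c W s e))
      (_ : IsMarkovKernel (levelKernel
        (η₀ ∘ₖ cycle (l₀.map (siteHeatBath (fun _ : Edge d L => haarProbability G)
              (gibbsDensity fun U : GaugeConfig d L G => β₀ * wilsonAction ρ U))))
        (η₁ ∘ₖ cycle (l₁.map (siteHeatBath (fun _ : Edge d L => haarProbability G)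
              (gibbsDensity fun U : GaugeConfig d L G => β₁ * wilsonAction ρ U)))))),
      ∀ (z : Bool × GaugeConfig d L G)
        [IsProbabilityMeasure (Kernel.trajMeasure (X := fun _ : ℕ => Bool × GaugeConfig d L G)
            (Measure.dirac z)
            (fun n : ℕ => (switchKernel κF κR c W s e ∘ₖ levelKernel
              (η₀ ∘ₖ cycle (l₀.map (siteHeatBath (fun _ : Edge d L => haarProbability G)
              (gibbsDensity fun U : GaugeConfig d L G => β₀ * wilsonAction ρ U))))
              (η₁ ∘ₖ cycle (l₁.map (siteHeatBath (fun _ : Edge d L => haarProbability G)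
              (gibbsDensity fun U : GaugeConfig d L G => β₁ * wilsonAction ρ U))))).comap
              (fun hh : (j : ↥(Finset.Iic n)) → Bool × GaugeConfig d L G =>
                hh ⟨n, Finset.mem_Iic.2 le_rfl⟩) (measurable_pi_apply _)))]
        {Ω' : Type*} [MeasurableSpace Ω'] {P' : Measure Ω'} [IsProbabilityMeasure P'] {Y : Ω' → ℝ},
        HasLaw Y (gaussianReal 0 (Real.toNNReal
          (2 * Scoring.tauInt (setACF (switchKernel κF κR c W s e ∘ₖ levelKernel
              (η₀ ∘ₖ cycle (l₀.map (siteHeatBath (fun _ : Edge d L => haarProbability G)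
              (gibbsDensity fun U : GaugeConfig d L G => β₀ * wilsonAction ρ U))))
              (η₁ ∘ₖ cycle (l₁.map (siteHeatBath (fun _ : Edge d L => haarProbability G)
              (gibbsDensity fun U : GaugeConfig d L G => β₁ * wilsonAction ρ U)))))
            ((jointWeight c (wilsonWeight (d := d) (L := L) ρ β₀)
                (wilsonWeight (d := d) (L := L) ρ β₁) univ)⁻¹ •
              jointWeight c (wilsonWeight (d := d) (L := L) ρ β₀) (wilsonWeight (d := d) (L := L) ρ β₁))
            (targetLevel (GaugeConfig d L G)))
            / (Real.sigmoid (c - ΔF) * (1 - Real.sigmoid (c - ΔF)))))) P' →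
        TendstoInDistribution (fun (n : ℕ) (x : ℕ → Bool × GaugeConfig d L G) =>
            Real.sqrt n * ((c - Real.log
              ((∑ i ∈ range n, (targetLevel (GaugeConfig d L G)).indicator
                  (1 : Bool × GaugeConfig d L G → ℝ) (x i)) / n /
                (1 - (∑ i ∈ range n, (targetLevel (GaugeConfig d L G)).indicator
                  (1 : Bool × GaugeConfig d L G → ℝ) (x i)) / n))) - ΔF))
          atTop Y (fun _ => Kernel.trajMeasure (X := fun _ : ℕ => Bool × GaugeConfig d L G)
            (Measure.dirac z)
            (fun n : ℕ => (switchKernel κF κR c W s e ∘ₖ levelKernel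
              (η₀ ∘ₖ cycle (l₀.map (siteHeatBath (fun _ : Edge d L => haarProbability G)
              (gibbsDensity fun U : GaugeConfig d L G => β₀ * wilsonAction ρ U))))
              (η₁ ∘ₖ cycle (l₁.map (siteHeatBath (fun _ : Edge d L => haarProbability G)
              (gibbsDensity fun U : GaugeConfig d L G => β₁ * wilsonAction ρ U))))).comap
              (fun hh : (j : ↥(Finset.Iic n)) → Bool × GaugeConfig d L G =>
                hh ⟨n, Finset.mem_Iic.2 le_rfl⟩) (measurable_pi_apply _))) P' := by
  obtain ⟨hMk₀, hfin₀, -, -, h0, -, hK₀, -⟩ := wilson_heatBathSweep_package ρ hρ β₀ hl₀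
  obtain ⟨hMk₁, hfin₁, -, -, h1, -, hK₁, -⟩ := wilson_heatBathSweep_package ρ hρ β₁ hl₁
  obtain ⟨m₀, hmfin₀, hm₀, hmin₀, hac₀⟩ := wilson_heatBath_minorising ρ hρ β₀ hl₀
  obtain ⟨m₁, hmfin₁, hm₁, hmin₁, hac₁⟩ := wilson_heatBath_minorising ρ hρ β₁ hl₁
  haveI := hMk₀
  haveI := hMk₁
  haveI := hfin₀
  haveI := hfin₁
  haveI := hmfin₀
  haveI := hmfin₁
  refine ⟨isMarkovKernel_switchKernel (κF := κF) (κR := κR) (c := c)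
      h.measurable_W h.measurable_s h.measurable_e, isMarkovKernel_levelKernel _ _,
    fun z _ Ω' _ P' _ Y hY => ?_⟩
  exact h.ncmc_dFocc_clt_of_exists_sq h0 h1 (hη₀.comp hK₀) (hη₁.comp hK₁)
    (h.ncmc_comp_exists_sq_doeblin _ η₀ _ η₁ hη₀ hη₁ hm₀ hm₁ hmin₀ hmin₁ hac₀ hac₁ c
      (h.bind_work_ne_ne_zero_of_ne h0 hΔF hc)) hΔF z hY

end WilsonComp

end Summit.Ventures.LatticeQCDFlow.Exactness.GeneralNCMC
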